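import Literature.NumberTheory.LFunctions.TuringMethodTrudgianIINumerics

/-!
# Trudgian's Theorem 1 (Turing's method II): evaluation of the certified computation

One compiled evaluation (`native_decide`) of
`Literature.NumberTheory.LFunctions.TrudgianIINumerics.trudgianIICheck` (see
`TuringMethodTrudgianIINumerics.lean` for the checker, its data, and its soundness theorem
`bounds_of_trudgianIICheck`): `209` certified Euler–Maclaurin evaluations of `ζ(σ)` at real
`σ ∈ [1.148, 30]` (scale `2^80`, `N = 50`, `ν = 10`), two more at `σ = 1.2619, 1.262`, six constants,
and four trapezoid sums over `ℚ`.  With it, Theorem 1 of [Trudgian 2016] — the named fact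
`Literature.NumberTheory.LFunctions.abs_integral_zetaArgS_le_trudgianII` of `TuringMethod.lean`,
`|∫_{t₁}^{t₂} S(t) dt| ≤ 1.698 + 0.183 log log t₂ + 0.049 log t₂` for `t₂ > t₁ > 10⁵` — holds
conditionally on exactly the paper's two explicit inputs [Trudgian 2016, proof of Cor. 1]: a
sub-convexity bound on the critical line ([PlattTrudgian2015, Cor. 2]:
`|ζ(½+it)| ≤ 0.732 |4.678+it|^{1/6} log|4.678+it|` for all `t`, or [HiaryPatelYang2024, Thm 1.1]:
`|ζ(½+it)| ≤ 0.618 t^{1/6} log t` for `t ≥ 3`) and Trudgian's `|ζ(1+it)| ≤ ¾ log t` for `t ≥ 3`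
[TrudgianZetaOne2014].  Everything else (Turing's lemma, Rademacher–Phragmén–Lindelöf, the
Hadamard-product lower bound with Booker's `log 4`, the numerics) is proved in the tree.  The only
non-standard axiom of this file is the `native_decide` auxiliary axiom of
`TrudgianIINumerics.trudgianIICheck_eq_true` (trust in the Lean compiler), declared to the gate as
`computational`.

## References

* T. S. Trudgian, *Improvements to Turing's method II*, Rocky Mountain J. Math. 46 (2016),
  325–332, Thm 1, Cor. 1.  [Trudgian2016]
* D. J. Platt, T. S. Trudgian, *An improved explicit bound on `|ζ(½+it)|`*, J. Number Theory 147
  (2015), 842–851, Cor. 2.  [PlattTrudgian2015]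
* G. A. Hiary, D. Patel, A. Yang, *An improved explicit estimate for `ζ(1/2+it)`*, J. Number Theory
  256 (2024), 195–217, Thm 1.1.  [HiaryPatelYang2024]
* T. S. Trudgian, *A new upper bound for `|ζ(1+it)|`*, Bull. Aust. Math. Soc. 89 (2014), 259–264.
  [TrudgianZetaOne2014]
-/

noncomputable section

open Complex

namespace Literature.NumberTheory.LFunctions

/-- **The certified computation passes**: `trudgianIICheck = true`. [cite: Trudgian2016, Table 1] -/
theorem TrudgianIINumerics.trudgianIICheck_eq_true : TrudgianIINumerics.trudgianIICheck = true := by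
  native_decide

/-- **Trudgian 2016, Theorem 1, conditional on the two edge bounds of Lemma 1** (`Q₀ = 10`,
`(k₁,…,k₅) = (0.732, 1/6, 1, ¾, 1)`): if `|ζ₁(½+iu)| ≤ 0.732 |10.5+iu|^{7/6} log|10.5+iu|` and
`|ζ₁(1+iu)| ≤ ¾ |11+iu| log|11+iu|` for all real `u` (`ζ₁(s) = (s−1)ζ(s)`), then
`|∫_{t₁}^{t₂} S(t) dt| ≤ 1.698 + 0.183 log log t₂ + 0.049 log t₂` for all `t₂ > t₁ > 10⁵`
(`Literature.NumberTheory.LFunctions.abs_integral_zetaArgS_le_trudgianII`). [cite: Trudgian2016, Thm 1] -/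
theorem abs_integral_zetaArgS_le_trudgianII_of_edge_bounds
    (H1 : ∀ u : ℝ, ‖riemannZeta₁ (1 / 2 + u * I)‖ ≤
      0.732 * ‖(10 : ℂ) + (1 / 2 + u * I)‖ ^ (7 / 6 : ℝ) * Real.log ‖(10 : ℂ) + (1 / 2 + u * I)‖)
    (H2 : ∀ u : ℝ, ‖riemannZeta₁ (1 + u * I)‖ ≤
      3 / 4 * ‖(10 : ℂ) + (1 + u * I)‖ * Real.log ‖(10 : ℂ) + (1 + u * I)‖) :
    abs_integral_zetaArgS_le_trudgianII :=
  abs_integral_zetaArgS_le_trudgianII_of_check TrudgianIINumerics.trudgianIICheck_eq_true H1 H2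

/-- **Trudgian 2016, Theorem 1, from the two published inputs quoted in the proof of its Cor. 1**:
the Platt–Trudgian bound `|ζ(½+it)| ≤ 0.732 |4.678+it|^{1/6} log|4.678+it|` (all real `t`)
[PlattTrudgian2015, Cor. 2] and Trudgian's `|ζ(1+it)| ≤ ¾ log t` (`t ≥ 3`) [TrudgianZetaOne2014]
imply `|∫_{t₁}^{t₂} S(t) dt| ≤ 1.698 + 0.183 log log t₂ + 0.049 log t₂` for `t₂ > t₁ > 10⁵`
(`Literature.NumberTheory.LFunctions.abs_integral_zetaArgS_le_trudgianII`).
[cite: Trudgian2016, Thm 1 and Cor. 1 (proof)] -/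
theorem abs_integral_zetaArgS_le_trudgianII_of_PT_TZ
    (hPT : ∀ t : ℝ, ‖riemannZeta (1 / 2 + t * I)‖ ≤
      0.732 * ‖((4.678 : ℝ) : ℂ) + t * I‖ ^ (1 / 6 : ℝ) * Real.log ‖((4.678 : ℝ) : ℂ) + t * I‖)
    (hTZ : ∀ t : ℝ, 3 ≤ t → ‖riemannZeta (1 + t * I)‖ ≤ 3 / 4 * Real.log t) :
    abs_integral_zetaArgS_le_trudgianII :=
  abs_integral_zetaArgS_le_trudgianII_of_edge_bounds (trudgianII_H1_of_PT hPT)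
    (trudgianII_H2_of_TZ hTZ)

/-- **Trudgian 2016, Theorem 1, from Hiary–Patel–Yang and Trudgian 2014**: the bounds
`|ζ(½+it)| ≤ 0.618 t^{1/6} log t` (`t ≥ 3`) [HiaryPatelYang2024, Thm 1.1] and
`|ζ(1+it)| ≤ ¾ log t` (`t ≥ 3`) [TrudgianZetaOne2014] imply
`|∫_{t₁}^{t₂} S(t) dt| ≤ 1.698 + 0.183 log log t₂ + 0.049 log t₂` for `t₂ > t₁ > 10⁵`
(`Literature.NumberTheory.LFunctions.abs_integral_zetaArgS_le_trudgianII`).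
[cite: Trudgian2016, Thm 1] [cite: HiaryPatelYang2024, Thm 1.1] -/
theorem abs_integral_zetaArgS_le_trudgianII_of_HPY_TZ
    (hHPY : ∀ t : ℝ, 3 ≤ t → ‖riemannZeta (1 / 2 + t * I)‖ ≤ 0.618 * t ^ (1 / 6 : ℝ) * Real.log t)
    (hTZ : ∀ t : ℝ, 3 ≤ t → ‖riemannZeta (1 + t * I)‖ ≤ 3 / 4 * Real.log t) :
    abs_integral_zetaArgS_le_trudgianII :=
  abs_integral_zetaArgS_le_trudgianII_of_edge_bounds (trudgianII_H1_of_HPY hHPY)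
    (trudgianII_H2_of_TZ hTZ)

end Literature.NumberTheory.LFunctions

end
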